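import Summits.BirchSwinnertonDyer.BirchSwinnertonDyer.Theorems.CongruentShaFreeCutTwoAdicSelmerFinite
import Summits.BirchSwinnertonDyer.BirchSwinnertonDyer.Theorems.MordellShaFreeCutThreeAdicLinks
import Summits.BirchSwinnertonDyer.Rank1Residual.GaloisImage.PropagatedConditionCardEP

/-! # Route `CongruentShaFreeCut` (rung S2) — crux `AnalyticRankOneOfRankOneFiniteShaTwo`
(stmt-BirchSwinnertonDyer-19080): Link A `TwoAdicControlOfRankOne` modulo ONE named fact
(Poitou–Tate), the local Euler–Poincaré characteristic being a TREE THEOREM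

Cell `bsd-cn100`, prover seat `bsd-cn100-s2-c3` g4. Supports, does not close,
stmt-BirchSwinnertonDyer-19080 (and, for the twin statements of route `MordellShaFreeCut`,
stmt-BirchSwinnertonDyer-19160). HONEST FRAMING: CONDITIONAL on the ONE textbook named fact
`poitouTate_sum_localTatePairing_eq_zero K` (Poitou–Tate: the sum of the local Tate pairings vanishes
on global classes, Milne ADT I Thm. 4.10(b) with Cor. 2.3 — the reciprocity law of the Brauer group;
not a tree theorem today) at the imaginary quadratic fields where Link A is demanded; nothing about
BSD, crux B, the leaf `rankOne_twoConverse_congruentNumber` or the congruent number problem is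
proved.

## What is proved

Generation g3 of this seat closed Link A of crux B's registered skeleton `two-adic-links`,
`CongruentShaFreeCutTwoAdicLinks.TwoAdicControlOfRankOne`, in the kernel MODULO two textbook named
facts (`CongruentShaFreeCutTwoAdicSelmerFinite.twoAdicControlOfRankOne_of_poitouTate_of_localEulerChar`,
p429679): Poitou–Tate (`hPT`) and Tate's local Euler–Poincaré characteristic formula (`hEP`,
`localEulerPoincareCharacteristic (K_v)`, Milne ADT I Thm. 2.8). The second is a THEOREM of the tree:
`Literature.NumberTheory.GaloisRepresentations.localEulerPoincareCharacteristic_holds` /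
`EPCTate.localEulerPoincareCharacteristic` (b2b cell, team n1011: reduction to one prime, `ℓ ≠ p` by
the prime-to-`p` Euler characteristic, `ℓ = p` by wild dévissage / tame chain / cyclic descent),
at the completions `K_v` as `GaloisImage.EP.forall_localEulerPoincareCharacteristic_adicCompletion`
(`GaloisImage/PropagatedConditionCardEP.lean`). Feeding it:

* `finite_selmerAcBase_of_rankOne_of_poitouTate` — g3's `finite_selmerAcBase_of_rankOne` (Castella's
  `Sel_𝔭(K, E[p^∞])` finite at a rank-one datum, ANY `p`, no `Irr`, no `Mult`) with `hEP` discharged: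
  CONDITIONAL on `hPT` at `K` only;
* **`twoAdicControlOfRankOne_of_poitouTate_imaginaryQuadratic`** — Link A from Poitou–Tate AT THE
  IMAGINARY QUADRATIC FIELDS only (the fields over which Link A is stated), and
  **`twoAdicControlOfRankOne_of_poitouTate`** — Link A from `∀ K, poitouTate_sum_localTatePairing_eq_zero K`
  (the binder form of the cell's stub-alias kit);
* `heegnerNonTorsionAtTwo_of_linkB_of_poitouTate`, **`cruxB_of_linkB_of_poitouTate`** — crux B
  `AnalyticRankOneOfRankOneFiniteShaTwo` from the OPEN Link B `TwoAdicCharValueEqHeegnerLogSq`, the six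
  refereed named facts of `cruxB_of_twoAdicLinks` (2-parity, modularity, Hoffstein–Luo, Kato, Gross
  1984, Gross–Zagier + Kolyvagin) and Poitou–Tate ONLY;
* the twins for route `MordellShaFreeCut` (rung S2b, stmt-19160), whose Link A
  `MordellShaFreeCutThreeAdicLinks.ThreeAdicControlOfRankOne` g3 closed by the same generic theorems
  (p429896, `MordellShaFreeCutThreeAdicControlOfSelmerFinite`): `threeAdicControlOfRankOne_of_poitouTate`,
  `cruxB_three_of_linkB_of_poitouTate` (re-derived here from the generic theorems; that module and
  g3's `CongruentShaFreeCutOfLinkB` are not imported).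

NET (numbers): the registered fact-free stub `stub_twoAdicControlOfRankOne` of item 19080 (and
`stub_threeAdicControlOfRankOne` of item 19160) is now ONE named fact away from stub credit:
`poitouTate_sum_localTatePairing_eq_zero` = `∃` a family of local invariant maps, perfect at the finite
places, with `∑_v inv_v (loc_v x ∪ loc_v y) = 0` on global classes (Albert–Brauer–Hasse–Noether /
Tate); the research content of crux B stays Link B.
[cite: MilneADT2006, Ch. I, Thm. 4.10(b) with Cor. 2.3 (hypothesis kept) and Thm. 2.8 (discharged)]
[cite: JetchevSkinnerWan2017, Prop. 3.2.1 and §3.3 (shape of Link A's proof)]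
[cite: CastellaGrossiLeeSkinner2022, §5.2 (proof of Thm. 5.2.1: shape of a BDP-type p-converse)] -/

set_option linter.dupNamespace false

noncomputable section

open scoped Classical

namespace Summit.BirchSwinnertonDyer.BirchSwinnertonDyer.Theorems.CongruentShaFreeCutTwoAdicControlOfPoitouTate

open WeierstrassCurve NumberField IsDedekindDomain Field Literature.NumberTheory.EllipticCurves
open Literature.NumberTheory.GaloisRepresentations Literature.NumberTheory.GaloisCohomology
open Summit.BirchSwinnertonDyer.Rank1Residual Summit.BirchSwinnertonDyer.Rank1Residual.X11b
open Summit.BirchSwinnertonDyer.Rank1Residual.X11b.AcSelmer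
open Summit.BirchSwinnertonDyer.BirchSwinnertonDyer.Theorems.CongruentShaFreeCutTwoAdicLinks
open Summit.BirchSwinnertonDyer.BirchSwinnertonDyer.Theorems.CongruentShaFreeCutTwoAdicControlOfSelmerFinite
open Summit.BirchSwinnertonDyer.BirchSwinnertonDyer.Theorems.CongruentShaFreeCutTwoAdicSelmerFinite
open Summit.BirchSwinnertonDyer.BirchSwinnertonDyer.Theorems.MordellShaFreeCutThreeAdicLinks
  (ThreeAdicControlOfRankOne ThreeAdicCharValueEqHeegnerLogSq cruxB_of_threeAdicLinks)

/-! ## 1. Castella's `Sel_𝔭(K, E[p^∞])` finite at a rank-one datum, modulo Poitou–Tate only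

The binder `hEP : ∀ v, localEulerPoincareCharacteristic (v.adicCompletion K)` of g3's theorems is the
tree theorem `GaloisImage.EP.forall_localEulerPoincareCharacteristic_adicCompletion K` (b2b cell,
`GaloisImage/PropagatedConditionCardEP.lean`, from `EPCTate.localEulerPoincareCharacteristic`). -/

/-- **`Sel_𝔭(K, E[p^∞])` is FINITE at a rank-one datum, granted Poitou–Tate at `K` only.** For an
elliptic, globally minimal `W/ℚ`, ANY prime `p`, an imaginary quadratic `K` with `p` split,
`rank E(K) = 1`, `#Ш(E/K)[p^∞] < ∞` and `𝔭 ∋ p`: Castella's Selmer group (strict at `𝔭`, relaxed at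
`𝔭̄`, trivial off `p`) is finite — g3's `finite_selmerAcBase_of_rankOne` (JSW Prop. 3.2.1 level bound
with the global index decoupled, limit over levels) with the local Euler characteristic supplied by
the tree theorem `EP.forall_localEulerPoincareCharacteristic_adicCompletion`. CONDITIONAL on `hPT`.
[cite: JetchevSkinnerWan2017, Prop. 3.2.1 (proof, arXiv:1512.06894 pp. 10–11)]
[cite: MilneADT2006, Ch. I, Thm. 4.10(b) (hypothesis) and Thm. 2.8 (discharged)] -/
theorem finite_selmerAcBase_of_rankOne_of_poitouTate (W : WeierstrassCurve ℚ) [W.IsElliptic]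
    [W.IsGloballyMinimal] (p : ℕ) [Fact p.Prime] (K : Type) [Field K] [NumberField K]
    (hPT : poitouTate_sum_localTatePairing_eq_zero K)
    (hK : IsImaginaryQuadratic K) (hsplit : SplitsIn K p)
    (hrank : (W.baseChange K).mordellWeilRank = 1)
    (hSha : Finite (AddCommGroup.primaryComponent (W.baseChange K).sha p))
    (𝔭 : HeightOneSpectrum (𝓞 K)) (h𝔭 : ((p : ℕ) : 𝓞 K) ∈ 𝔭.asIdeal) :
    Finite (selmerAcBase (W.baseChange K) p 𝔭 ∅) :=
  finite_selmerAcBase_of_rankOne W p K hPT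
    (GaloisImage.EP.forall_localEulerPoincareCharacteristic_adicCompletion K) hK hsplit hrank hSha 𝔭 h𝔭

/-! ## 2. Link A of crux B modulo Poitou–Tate only -/

/-- **Link A `TwoAdicControlOfRankOne` holds, granted Poitou–Tate AT THE IMAGINARY QUADRATIC FIELDS**
(the only fields at which Link A is demanded). At a datum of Link A (square-free `n`, `K` imaginary
quadratic with the Heegner hypothesis for `2`, so `2` splits in `K`; `v̄ ∋ 2`; `rank E_n(K) = 1`,
`#Ш(E_n/K)[2^∞] < ∞`) the base Selmer group is finite by
`finite_selmerAcBase_of_rankOne_of_poitouTate`, and g3's `twoAdicControlOfRankOne_of_finite_selmerAcBase`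
(local kernels incl. the strict place, control, Nakayama, Greenberg's criterion — X11b kernel theorems)
does the rest. CONDITIONAL on Poitou–Tate for imaginary quadratic `K`; the local Euler characteristic
is no longer a hypothesis. [cite: MilneADT2006, Ch. I, Thm. 4.10(b) (hypothesis kept)]
[cite: JetchevSkinnerWan2017, Prop. 3.2.1 and §3.3] [cite: GreenbergLNM1716, §3 Lemma 3.3, p. 90; §4 Lemma 4.2] -/
theorem twoAdicControlOfRankOne_of_poitouTate_imaginaryQuadratic
    (hPT : ∀ (K : Type) [Field K] [NumberField K], IsImaginaryQuadratic K →
      poitouTate_sum_localTatePairing_eq_zero K) :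
    TwoAdicControlOfRankOne :=
  twoAdicControlOfRankOne_of_finite_selmerAcBase
    fun n hn K _ _ _N _ _hN hK _hHN hH2 _ι _v vbar _hv hvbar _hne hrank hsha ↦ by
      haveI := isElliptic_congruentNumberCurve hn.ne_zero
      haveI := isGloballyMinimal_congruentNumberCurve hn
      exact finite_selmerAcBase_of_rankOne_of_poitouTate (congruentNumberCurve n) 2 K (hPT K hK) hK
        (hH2 2 Fact.out (dvd_refl 2)) hrank hsha vbar hvbar

/-- **Link A `TwoAdicControlOfRankOne` holds, granted Poitou–Tate** (`∀ K`, the binder form of the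
cell's stub-alias kit): g3's `twoAdicControlOfRankOne_of_poitouTate_of_localEulerChar` with its second
hypothesis DISCHARGED by the tree theorem `localEulerPoincareCharacteristic_holds`. So the registered
fact-free stub `stub_twoAdicControlOfRankOne` of item 19080 is ONE named fact (Poitou–Tate, Milne ADT
I 4.10(b)/Cor. 2.3 = the reciprocity law of the Brauer group with Tate local duality) away from being
a tree theorem. CONDITIONAL; credits nothing. [cite: MilneADT2006, Ch. I, Thm. 4.10(b) (hypothesis kept) and Thm. 2.8 (discharged)] -/
theorem twoAdicControlOfRankOne_of_poitouTate
    (hPT : ∀ (K : Type) [Field K] [NumberField K], poitouTate_sum_localTatePairing_eq_zero K) :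
    TwoAdicControlOfRankOne :=
  twoAdicControlOfRankOne_of_poitouTate_imaginaryQuadratic fun K _ _ _ ↦ hPT K

/-! ## 3. Crux B from Link B, six refereed facts and Poitou–Tate only -/

/-- **`HeegnerNonTorsionAtTwo` from Link B**, Kato (`hKato`) and Poitou–Tate (`hPT`): g3's
`heegnerNonTorsionAtTwo_of_linkB` with the local Euler characteristic discharged. CONDITIONAL on the
OPEN Link B. [cite: CastellaGrossiLeeSkinner2022, §5.2 (proof of Thm. 5.2.1)]
[cite: MilneADT2006, Ch. I, Thm. 4.10(b) (hypothesis kept)] -/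
theorem heegnerNonTorsionAtTwo_of_linkB_of_poitouTate
    (hKato : ∀ (W : WeierstrassCurve ℚ) [W.IsElliptic] (p : ℕ) [Fact p.Prime],
      kato_finite_of_L_one_ne_zero W p)
    (hPT : ∀ (K : Type) [Field K] [NumberField K], poitouTate_sum_localTatePairing_eq_zero K)
    (hB : TwoAdicCharValueEqHeegnerLogSq) :
    CongruentShaFreeCutOfHeegnerNonTorsion.HeegnerNonTorsionAtTwo :=
  heegnerNonTorsionAtTwo_of_twoAdicLinks hKato (twoAdicControlOfRankOne_of_poitouTate hPT) hB

/-- **Crux B `AnalyticRankOneOfRankOneFiniteShaTwo` from LINK B, six refereed named facts and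
Poitou–Tate**: `2`-parity (`hpar`), modularity (`hmod`), Hoffstein–Luo (`hHL`), Kato (`hKato`),
existence of Heegner points (`hHP`, Gross 1984), Gross–Zagier + Kolyvagin over `K` (`hGZ`),
Poitou–Tate (`hPT`) and the OPEN Link B (`hB`). = `cruxB_of_twoAdicLinks` (p424074) with Link A
DISCHARGED modulo Poitou–Tate (`twoAdicControlOfRankOne_of_poitouTate`); g3's `cruxB_of_linkB` minus
its `hEP` binder. CONDITIONAL; credits nothing; the research content of item 19080 is Link B.
[cite: CastellaGrossiLeeSkinner2022, §5.2 (proof of Thm. 5.2.1)] [cite: GrossZagier1986, Thm. I.6.3 with V.§2]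
[cite: MilneADT2006, Ch. I, Thm. 4.10(b) (hypothesis kept)] -/
theorem cruxB_of_linkB_of_poitouTate
    (hpar : ∀ (W : WeierstrassCurve ℚ) [W.IsElliptic] (p : ℕ) [Fact p.Prime], p_parity W p)
    (hmod : ModularForms.exists_isNewformOf) (hHL : HoffsteinLuo1997_exists_twist_L_one_ne_zero)
    (hKato : ∀ (W : WeierstrassCurve ℚ) [W.IsElliptic] (p : ℕ) [Fact p.Prime],
      kato_finite_of_L_one_ne_zero W p)
    (hHP : ∀ (W : WeierstrassCurve ℚ) (K : Type) [Field K] [NumberField K],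
      exists_isHeegnerPoint W K)
    (hGZ : ∀ (W : WeierstrassCurve ℚ) (N : ℕ) [NeZero N] (K : Type) [Field K] [NumberField K],
      analyticRankEK_eq_one_iff_heegner_nonTorsion W N K)
    (hPT : ∀ (K : Type) [Field K] [NumberField K], poitouTate_sum_localTatePairing_eq_zero K)
    (hB : TwoAdicCharValueEqHeegnerLogSq) :
    Summit.BirchSwinnertonDyer.BirchSwinnertonDyer.Theses.CongruentShaFreeCut.AnalyticRankOneOfRankOneFiniteShaTwo :=
  cruxB_of_twoAdicLinks hpar hmod hHL hKato hHP hGZ (twoAdicControlOfRankOne_of_poitouTate hPT) hB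

/-! ## 4. The twins for route `MordellShaFreeCut` (rung S2b, stmt-BirchSwinnertonDyer-19160) -/

/-- **Link A of S2b, `ThreeAdicControlOfRankOne`, holds granted Poitou–Tate** (`∀ K`): the proof of
g3's `threeAdicControlOfRankOne_of_poitouTate_of_localEulerChar` (p429896; the generic theorems
`finite_selmerAcBase_of_rankOne` / `hasCharValuationAt_of_finite_selmerAcBase` at `p = 3`, hypothesis
`j = 0` unused) with the local Euler characteristic DISCHARGED. CONDITIONAL; credits nothing. [cite: MilneADT2006, Ch. I, Thm. 4.10(b) (hypothesis kept) and Thm. 2.8 (discharged)]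
[cite: JetchevSkinnerWan2017, Prop. 3.2.1 and §3.3] -/
theorem threeAdicControlOfRankOne_of_poitouTate
    (hPT : ∀ (K : Type) [Field K] [NumberField K], poitouTate_sum_localTatePairing_eq_zero K) :
    ThreeAdicControlOfRankOne := by
  intro W _ _ _hj K _ _ N _ _hN hK _hHN hH3 ι v vbar _hv hvbar _hne κ hκ γ _ hrank hsha
  have hsplit : SplitsIn K 3 := hH3 3 Fact.out (dvd_refl 3)
  haveI : Finite (selmerAcBase (W.baseChange K) 3 vbar ∅) :=
    finite_selmerAcBase_of_rankOne_of_poitouTate W 3 K (hPT K) hK hsplit hrank hsha vbar hvbar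
  exact hasCharValuationAt_of_finite_selmerAcBase W 3 hK hsplit κ hκ γ vbar hvbar

/-- **Crux B of S2b `AnalyticRankOneOfRankOneFiniteShaThree` from its Link B
`ThreeAdicCharValueEqHeegnerLogSq`, six refereed named facts and Poitou–Tate** — the S2b twin of
`cruxB_of_linkB_of_poitouTate` (`cruxB_of_threeAdicLinks`, p424081, with Link A supplied by
`threeAdicControlOfRankOne_of_poitouTate`). CONDITIONAL; credits nothing.
[cite: CastellaGrossiLeeSkinner2022, §5.2 (proof of Thm. 5.2.1)] [cite: GrossZagier1986, Thm. I.6.3 with V.§2]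
[cite: MilneADT2006, Ch. I, Thm. 4.10(b) (hypothesis kept)] -/
theorem cruxB_three_of_linkB_of_poitouTate
    (hpar : ∀ (W : WeierstrassCurve ℚ) [W.IsElliptic] (p : ℕ) [Fact p.Prime], p_parity W p)
    (hmod : ModularForms.exists_isNewformOf) (hHL : HoffsteinLuo1997_exists_twist_L_one_ne_zero)
    (hKato : ∀ (W : WeierstrassCurve ℚ) [W.IsElliptic] (p : ℕ) [Fact p.Prime],
      kato_finite_of_L_one_ne_zero W p)
    (hHP : ∀ (W : WeierstrassCurve ℚ) (K : Type) [Field K] [NumberField K],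
      exists_isHeegnerPoint W K)
    (hGZ : ∀ (W : WeierstrassCurve ℚ) (N : ℕ) [NeZero N] (K : Type) [Field K] [NumberField K],
      analyticRankEK_eq_one_iff_heegner_nonTorsion W N K)
    (hPT : ∀ (K : Type) [Field K] [NumberField K], poitouTate_sum_localTatePairing_eq_zero K)
    (hB : ThreeAdicCharValueEqHeegnerLogSq) :
    Summit.BirchSwinnertonDyer.BirchSwinnertonDyer.Theses.MordellShaFreeCut.AnalyticRankOneOfRankOneFiniteShaThree :=
  cruxB_of_threeAdicLinks hpar hmod hHL hKato hHP hGZ (threeAdicControlOfRankOne_of_poitouTate hPT) hB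

end Summit.BirchSwinnertonDyer.BirchSwinnertonDyer.Theorems.CongruentShaFreeCutTwoAdicControlOfPoitouTate

end
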